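import Literature.NumberTheory.Transcendental.TorusStabilizer
import HarnessLib

/-!
# Counting cosets of a subtorus in a subset of `(ℂˣ)^d` cut out by polynomials of degree `≤ D`

Topic: `Literature/NumberTheory/Transcendental` — the counting step of the proof of the zero
estimate on `𝔾ₘ^d` (`Philippon1986_zeroEstimate_torus`, `TorusZeroEstimate.lean`): Nesterenko–
Philippon (eds.), LNM 1752, Ch. 11, proof of Thm. 4.1, p. 220, "`𝓗(𝔄; D) ≤ 𝓗(G; D)`" (Prop. 2.2)
combined with "`𝓗(Σ + H; D) ≥ Card((Σ + H₀)/H₀) 𝓗(H₀; D)`" (Prop. 2.3), in the following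
self-contained form for the torus:

**`ncard_image_mk_le_pow`.** Let `A ≤ ℤ^d`, `E ⊆ T = (ℂˣ)^d` a union of cosets of `H_A` which is
the set of common zeros in `T` of a family `𝓕` of polynomials of degree `≤ D` (`D ≥ 1`), meeting
finitely many cosets. Then the number of cosets of `H_A` in `E` is at most `D^{rank A}`.

Proof: pass to the cone `Ê ⊆ (ℂˣ)^{d+1}` (torus points `ĝ` with `(ĝ_i/ĝ_0)_i ∈ E`), the common
zeros in the torus of the homogenisations `q^h` (`TorusConeBasics.lean`), a union of cosets of the
cone subtorus `H_Â`, `Â = {â | Σ â_j = 0, (â_1, …, â_d) ∈ A}`. For each coset pick a minimal prime of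
its vanishing ideal of maximal dimension `ν`; these are pairwise distinct RELEVANT minimal primes of
`𝔞 = (q^h : q ∈ 𝓕)` (cosets of subtori are closed in the torus, `TorusConeBasics`; relevant primes
are determined by their torus points, `TorusScaling`), every relevant minimal prime of `𝔞` has
dimension `≤ ν`, and `ν ≥ d + 1 - rank A` (`TorusConeDimension`). The Bézout-type count
`Literature.RingTheory.MvPolynomial.card_le_pow_of_relevant_minimalPrimes` (LNM 1752 Ch. 11
Prop. 2.2) bounds their number by `D^{(d+1) - ν} ≤ D^{rank A}`.

## References

* Yu. V. Nesterenko, P. Philippon (eds.), *Introduction to Algebraic Independence Theory*,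
  LNM 1752 (2001), Ch. 11 (D. Roy), Prop. 2.2, Prop. 2.3 and the proof of Thm. 4.1 (p. 220).
  [NesterenkoPhilippon2001]
-/

noncomputable section

open MvPolynomial

namespace Literature.NumberTheory.Transcendental

open Torus

variable {d : ℕ}

local notation "ρ'[" g "]" =>
  (MvPolynomial.aeval (R := ℂ) (S₁ := MvPolynomial (Fin (d + 1)) ℂ)
    (fun i : Fin (d + 1) => MvPolynomial.C (((g : Fin (d + 1) → ℂˣ) i : ℂˣ) : ℂ) * MvPolynomial.X i))
-- dehomogenisation of a cone point `ĝ ↦ (ĝ_{i+1} / ĝ_0)_i`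
local notation "dh" => (fun (g : Torus (d + 1)) (i : Fin d) => g (Fin.succ i) * (g 0)⁻¹)

/-! ## The cone over the torus -/

/-- `∏ x^{a_i} = x^{Σ a_i}`. [folklore] -/
theorem prod_zpow_eq_zpow_sum {G : Type*} [CommGroup G] (x : G) {ι : Type*} (s : Finset ι) (a : ι → ℤ) :
    ∏ i ∈ s, x ^ a i = x ^ ∑ i ∈ s, a i := by
  classical
  induction s using Finset.induction_on with
  | empty => simp
  | insert j s hj ih => rw [Finset.prod_insert hj, Finset.sum_insert hj, ih, zpow_add]

/-- Characters of the cone torus with coordinate sum zero factor through dehomogenisation: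
`χ_â(ĝ) = χ_{(â_1,…,â_d)}(ĝ_1/ĝ_0, …, ĝ_d/ĝ_0)` if `â_0 + Σ_{i ≥ 1} â_i = 0`. [folklore] -/
theorem char_eq_char_tail_dh (â : Fin (d + 1) → ℤ) (hsum : â 0 + ∑ i : Fin d, â (Fin.succ i) = 0)
    (g : Torus (d + 1)) : char â g = char (fun i => â (Fin.succ i)) (dh g) := by
  simp only [char_apply]
  rw [Fin.prod_univ_succ]
  simp only [mul_zpow, Finset.prod_mul_distrib]
  rw [prod_zpow_eq_zpow_sum, inv_zpow', show -(∑ i : Fin d, â (Fin.succ i)) = â 0 by omega, mul_comm]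

/-- The embedding `g ↦ (1, g)` of `T` in the cone torus and dehomogenisation. [folklore] -/
theorem dh_cons_mul (g : Torus d) (ĝ : Torus (d + 1)) :
    dh ((Fin.cons 1 g : Torus (d + 1)) * ĝ) = g * dh ĝ := by
  funext i
  simp only [Pi.mul_apply, Fin.cons_succ, Fin.cons_zero, one_mul]
  rw [mul_assoc]

/-- A cone point is `(λ, λ y)` with `λ = ĝ_0`, `y` the dehomogenised point. [folklore] -/
theorem torus_eq_cons_smul (ĝ : Torus (d + 1)) :
    (fun i => ((ĝ i : ℂˣ) : ℂ)) = Fin.cons ((ĝ 0 : ℂˣ) : ℂ)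
      (((ĝ 0 : ℂˣ) : ℂ) • fun i : Fin d => (((ĝ (Fin.succ i) * (ĝ 0)⁻¹ : ℂˣ)) : ℂ)) := by
  funext j
  refine Fin.cases ?_ (fun i => ?_) j
  · simp
  · simp only [Fin.cons_succ, Pi.smul_apply, smul_eq_mul, Units.val_mul]
    rw [mul_comm, mul_assoc, ← Units.val_mul, inv_mul_cancel, Units.val_one, mul_one]

/-- **Common zeros of the homogenisations in the cone torus are the cone over `E`.**
[folklore] -/
theorem forall_aevalAt_homogenization_iff {𝓕 : Set (MvPolynomial (Fin d) ℂ)} {D : ℕ}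
    (hdeg : ∀ q ∈ 𝓕, q.totalDegree ≤ D) (ĝ : Torus (d + 1)) :
    (∀ q ∈ 𝓕, aevalAt (∑ m ∈ q.support, monomial (Finsupp.cons (D - m.degree) m) (coeff m q) :
          MvPolynomial (Fin (d + 1)) ℂ) ĝ = 0) ↔
      ∀ q ∈ 𝓕, aevalAt q (dh ĝ) = 0 := by
  refine forall₂_congr fun q hq => ?_
  rw [aevalAt_eq_aeval, aevalAt_eq_aeval]
  beta_reduce
  rw [torus_eq_cons_smul, aeval_cons_smul_homogenization (hdeg q hq), mul_eq_zero,
    or_iff_right (pow_ne_zero _ (Units.ne_zero _))]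

/-! ## The count -/

/-- **The number of cosets of `H_A` in a subset of `T` cut out by polynomials of degree `≤ D` is at
most `D^{rank A}`** (Nesterenko–Philippon LNM 1752, Ch. 11, proof of Thm. 4.1 p. 220: Prop. 2.2
with Prop. 2.3, for `G = 𝔾ₘ^d`): if `E ⊆ (ℂˣ)^d` is the set of torus zeros of a family `𝓕` of
polynomials of degree `≤ D`, `D ≥ 1`, is stable under `H_A`, and meets finitely many cosets of
`H_A`, then it meets at most `D^{rank A}` of them.
[cite: NesterenkoPhilippon2001, Ch. 11 Thm 4.1 (proof, p. 220) + Prop 2.2] -/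
theorem ncard_image_mk_le_pow {A : AddSubgroup (Fin d → ℤ)} {E : Set (Torus d)}
    {𝓕 : Set (MvPolynomial (Fin d) ℂ)} {D : ℕ} (hD : 1 ≤ D) (hdeg : ∀ q ∈ 𝓕, q.totalDegree ≤ D)
    (hE : ∀ g : Torus d, g ∈ E ↔ ∀ q ∈ 𝓕, aevalAt q g = 0)
    (hstab : ∀ g ∈ E, ∀ h ∈ subtorus A, g * h ∈ E)
    (hfin : ((QuotientGroup.mk : Torus d → Torus d ⧸ subtorus A) '' E).Finite) :
    Set.ncard ((QuotientGroup.mk : Torus d → Torus d ⧸ subtorus A) '' E) ≤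
      D ^ Module.finrank ℤ (AddSubgroup.toIntSubmodule A) := by
  classical
  set π : Torus d → Torus d ⧸ subtorus A := QuotientGroup.mk with hπ
  set Q := hfin.toFinset with hQ
  have hmemQ : ∀ c, c ∈ Q ↔ ∃ g ∈ E, π g = c := fun c => by
    rw [hQ, Set.Finite.mem_toFinset, Set.mem_image]
  rw [Set.ncard_eq_toFinset_card _ hfin, ← hQ]
  -- representatives
  have hrep : ∀ c : Torus d ⧸ subtorus A, ∃ g : Torus d, c ∈ Q → g ∈ E ∧ π g = c := by
    intro c
    by_cases hc : c ∈ Q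
    · obtain ⟨g, hg, hgc⟩ := (hmemQ c).mp hc
      exact ⟨g, fun _ => ⟨hg, hgc⟩⟩
    · exact ⟨1, fun h => absurd h hc⟩
  choose rep hrep using hrep
  -- the cone lattice `Â`
  let Â : AddSubgroup (Fin (d + 1) → ℤ) :=
    { carrier := {â | â 0 + ∑ i : Fin d, â (Fin.succ i) = 0 ∧ (fun i => â (Fin.succ i)) ∈ A}
      zero_mem' := ⟨by simp, show (fun _ => (0 : ℤ)) ∈ A from A.zero_mem⟩
      add_mem' := by
        rintro a b ⟨ha, haA⟩ ⟨hb, hbA⟩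
        refine ⟨?_, ?_⟩
        · simp only [Pi.add_apply, Finset.sum_add_distrib]; omega
        · exact A.add_mem haA hbA
      neg_mem' := by
        rintro a ⟨ha, haA⟩
        refine ⟨?_, ?_⟩
        · simp only [Pi.neg_apply, Finset.sum_neg_distrib]; omega
        · exact A.neg_mem haA }
  have hmemÂ : ∀ â, â ∈ Â ↔ â 0 + ∑ i : Fin d, â (Fin.succ i) = 0 ∧
      (fun i => â (Fin.succ i)) ∈ A := fun â => Iff.rfl
  -- (K1) membership in `H_Â` through dehomogenisation
  have hK1 : ∀ ĝ : Torus (d + 1), ĝ ∈ subtorus Â ↔ dh ĝ ∈ subtorus A := by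
    intro ĝ
    rw [mem_subtorus, mem_subtorus]
    constructor
    · intro h a ha
      have hmem : (Fin.cons (-(∑ i : Fin d, a i)) a : Fin (d + 1) → ℤ) ∈ Â := by
        rw [hmemÂ]
        simp only [Fin.cons_zero, Fin.cons_succ]
        exact ⟨by omega, ha⟩
      have := h _ hmem
      rwa [char_eq_char_tail_dh _ (by simp)] at this
    · intro h â hâ
      obtain ⟨hsum, htail⟩ := (hmemÂ â).mp hâ
      rw [char_eq_char_tail_dh â hsum]
      exact h _ htail
  -- the cosets of `H_Â` over the cosets of `H_A` in `E`
  have hcone : ∀ (c : Torus d ⧸ subtorus A) (ĝ : Torus (d + 1)),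
      (Fin.cons 1 (rep c) : Torus (d + 1))⁻¹ * ĝ ∈ subtorus Â ↔ (rep c)⁻¹ * dh ĝ ∈ subtorus A := by
    intro c ĝ
    rw [hK1, show (Fin.cons 1 (rep c) : Torus (d + 1))⁻¹ = Fin.cons 1 (rep c)⁻¹ by
      funext j; refine Fin.cases ?_ (fun i => ?_) j <;> simp, dh_cons_mul]
  -- the vanishing ideals of the cone cosets and their common dimension
  set V₀ : Set (Fin (d + 1) → ℂ) := (fun (g : Torus (d + 1)) (i : Fin (d + 1)) => ((g i : ℂˣ) : ℂ)) '' (subtorus Â : Set (Torus (d + 1))) with hV₀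
  have hVc : ∀ c : Torus d ⧸ subtorus A,
      (fun (g : Torus (d + 1)) (i : Fin (d + 1)) => ((g i : ℂˣ) : ℂ)) '' {ĝ | (Fin.cons 1 (rep c) : Torus (d + 1))⁻¹ * ĝ ∈ subtorus Â} =
        ((Fin.cons 1 (rep c) : Torus (d + 1)) • ·) '' V₀ := by
    intro c
    ext x
    simp only [hV₀, Set.mem_image, Set.mem_setOf_eq, SetLike.mem_coe]
    constructor
    · rintro ⟨ĝ, hĝ, rfl⟩
      refine ⟨(fun (g : Torus (d + 1)) (i : Fin (d + 1)) => ((g i : ℂˣ) : ℂ)) ((Fin.cons 1 (rep c) : Torus (d + 1))⁻¹ * ĝ), ⟨_, hĝ, rfl⟩, ?_⟩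
      funext j
      simp [Units.smul_def]
    · rintro ⟨_, ⟨ĥ, hĥ, rfl⟩, rfl⟩
      refine ⟨(Fin.cons 1 (rep c) : Torus (d + 1)) * ĥ, by rwa [inv_mul_cancel_left], ?_⟩
      funext j
      simp [Units.smul_def]
  -- points of the cone cosets dehomogenise into `E`
  have hĈE : ∀ c ∈ Q, ∀ ĝ : Torus (d + 1),
      (Fin.cons 1 (rep c) : Torus (d + 1))⁻¹ * ĝ ∈ subtorus Â → dh ĝ ∈ E := by
    intro c hc ĝ h
    rw [hcone] at h
    have := hstab (rep c) (hrep c hc).1 _ h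
    rwa [mul_inv_cancel_left] at this
  -- the common dimension `ν` of the cone cosets
  set I₀ : Ideal (MvPolynomial (Fin (d + 1)) ℂ) := vanishingIdeal ℂ V₀ with hI₀
  have hdimc : ∀ c : Torus d ⧸ subtorus A,
      ringKrullDim (MvPolynomial (Fin (d + 1)) ℂ ⧸
        vanishingIdeal ℂ ((fun (g : Torus (d + 1)) (i : Fin (d + 1)) => ((g i : ℂˣ) : ℂ)) '' {ĝ | (Fin.cons 1 (rep c) : Torus (d + 1))⁻¹ * ĝ ∈ subtorus Â})) =
        ringKrullDim (MvPolynomial (Fin (d + 1)) ℂ ⧸ I₀) := by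
    intro c
    rw [hVc c, vanishingIdeal_smul_eq_comap, ringKrullDim_quotient_comap_scale]
  have hI₀ne : I₀ ≠ ⊤ := by
    intro htop
    have h1 : (1 : MvPolynomial (Fin (d + 1)) ℂ) ∈ I₀ := by rw [htop]; exact Submodule.mem_top
    rw [hI₀, mem_vanishingIdeal_iff] at h1
    have := h1 ((fun (g : Torus (d + 1)) (i : Fin (d + 1)) => ((g i : ℂˣ) : ℂ)) 1) ⟨1, (subtorus Â).one_mem, rfl⟩
    rw [map_one] at this
    exact one_ne_zero this
  obtain ⟨ν, hν, -⟩ :=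
    Literature.RingTheory.MvPolynomial.exists_nat_ringKrullDim_quotient_eq (K := ℂ) hI₀ne
  -- `ν ≥ d + 1 - rank A` through transversal coordinates
  obtain ⟨U, hUcard, hU⟩ := exists_transversal_coordinates A
  set W : Finset (Fin (d + 1)) := insert 0 (U.map ⟨Fin.succ, Fin.succ_injective d⟩) with hWdef
  have hW : ∀ â ∈ Â, (∀ j, j ∉ W → â j = 0) → â = 0 := by
    intro â hâ hsupp
    obtain ⟨hsum, htail⟩ := (hmemÂ â).mp hâ
    have htail0 : (fun i => â (Fin.succ i)) = 0 := hU _ htail fun i hi => hsupp _ (by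
      rw [hWdef, Finset.mem_insert, Finset.mem_map]
      push Not
      exact ⟨Fin.succ_ne_zero i, fun i' hi' h => hi (by rwa [← Fin.succ_injective d h])⟩)
    have h0 : â 0 = 0 := by
      have : ∀ i, â (Fin.succ i) = 0 := fun i => congr_fun htail0 i
      simp only [this, Finset.sum_const_zero, add_zero] at hsum
      exact hsum
    funext j
    refine Fin.cases h0 (fun i => congr_fun htail0 i) j
  have hWcard : W.card = U.card + 1 := by
    rw [hWdef, Finset.card_insert_of_notMem, Finset.card_map]
    rw [Finset.mem_map]
    push Not
    intro i _
    exact Fin.succ_ne_zero i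
  have hνW := card_le_ringKrullDim_quotient_vanishingIdeal Â hW
  rw [← hI₀, hν, hWcard] at hνW
  have hνge : d + 1 ≤ ν + Module.finrank ℤ (AddSubgroup.toIntSubmodule A) := by
    have : U.card + 1 ≤ ν := by exact_mod_cast hνW
    omega
  have hνpos : 1 ≤ ν := by
    have : U.card + 1 ≤ ν := by exact_mod_cast hνW
    omega
  obtain ⟨a, rfl⟩ : ∃ a, ν = a + 1 := ⟨ν - 1, by omega⟩
  -- the primes `𝔭 c`: minimal primes of the cone cosets of dimension `ν`
  have hexP : ∀ c : Torus d ⧸ subtorus A, ∃ 𝔭 ∈ (vanishingIdeal ℂ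
      ((fun (g : Torus (d + 1)) (i : Fin (d + 1)) => ((g i : ℂˣ) : ℂ)) '' {ĝ | (Fin.cons 1 (rep c) : Torus (d + 1))⁻¹ * ĝ ∈ subtorus Â})).minimalPrimes,
      ringKrullDim (MvPolynomial (Fin (d + 1)) ℂ ⧸ 𝔭) = (a + 1 : ℕ) := fun c =>
    Literature.RingTheory.MvPolynomial.exists_minimalPrimes_ringKrullDim_quotient_eq
      (by rw [hdimc c, hν])
  choose 𝔭 h𝔭min h𝔭dim using hexP
  have hrel𝔭 : ∀ c j, (X j : MvPolynomial (Fin (d + 1)) ℂ) ∉ 𝔭 c := fun c j =>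
    forall_X_notMem_of_mem_minimalPrimes_vanishingIdeal (by
      rintro _ ⟨ĝ, -, rfl⟩ i
      exact Units.ne_zero _) (h𝔭min c) j
  -- the homogenised family and its ideal
  set G : Set (MvPolynomial (Fin (d + 1)) ℂ) := (fun q : MvPolynomial (Fin d) ℂ =>
    ∑ m ∈ q.support, monomial (Finsupp.cons (D - m.degree) m) (coeff m q)) '' 𝓕 with hGdef
  set 𝔞 : Ideal (MvPolynomial (Fin (d + 1)) ℂ) := Ideal.span G with h𝔞def
  have hZ : ∀ ĝ : Torus (d + 1), (∀ f ∈ 𝔞, MvPolynomial.aeval ((fun (g : Torus (d + 1)) (i : Fin (d + 1)) => ((g i : ℂˣ) : ℂ)) ĝ) f = 0) ↔ dh ĝ ∈ E := by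
    intro ĝ
    rw [hE, ← forall_aevalAt_homogenization_iff hdeg ĝ]
    simp only [aevalAt_eq_aeval]
    constructor
    · intro h q hq
      exact h _ (Ideal.subset_span ⟨q, hq, rfl⟩)
    · intro h f hf
      have hle : 𝔞 ≤ vanishingIdeal ℂ {(fun (g : Torus (d + 1)) (i : Fin (d + 1)) => ((g i : ℂˣ) : ℂ)) ĝ} := by
        rw [h𝔞def, Ideal.span_le]
        rintro _ ⟨q, hq, rfl⟩
        rw [SetLike.mem_coe, mem_vanishingIdeal_iff]
        rintro x hx
        rw [Set.mem_singleton_iff.mp hx]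
        exact h q hq
      exact (mem_vanishingIdeal_iff.mp (hle hf)) _ (Set.mem_singleton _)
  -- (P3) a relevant prime over `𝔞` contains the ideal of some cone coset
  have hP3 : ∀ 𝔮 : Ideal (MvPolynomial (Fin (d + 1)) ℂ), 𝔮.IsPrime →
      (∀ j, (X j : MvPolynomial (Fin (d + 1)) ℂ) ∉ 𝔮) → 𝔞 ≤ 𝔮 →
      ∃ c ∈ Q, vanishingIdeal ℂ
        ((fun (g : Torus (d + 1)) (i : Fin (d + 1)) => ((g i : ℂˣ) : ℂ)) '' {ĝ | (Fin.cons 1 (rep c) : Torus (d + 1))⁻¹ * ĝ ∈ subtorus Â}) ≤ 𝔮 := by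
    intro 𝔮 h𝔮 hrel h𝔞𝔮
    by_contra hcon
    push Not at hcon
    have hf : ∀ c ∈ Q, ∃ f ∈ vanishingIdeal ℂ
        ((fun (g : Torus (d + 1)) (i : Fin (d + 1)) => ((g i : ℂˣ) : ℂ)) '' {ĝ | (Fin.cons 1 (rep c) : Torus (d + 1))⁻¹ * ĝ ∈ subtorus Â}), f ∉ 𝔮 :=
      fun c hc => Set.not_subset.mp (hcon c hc)
    choose! f hfI hf𝔮 using hf
    have hF : (∏ c ∈ Q, f c) ∈ 𝔮 := by
      rw [← vanishingIdeal_zeroLocus_inter_torus hrel, mem_vanishingIdeal_iff]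
      rintro x ⟨hx𝔮, hxU⟩
      obtain ⟨ĝ, rfl⟩ := exists_torus_eq hxU
      have hE' : dh ĝ ∈ E := (hZ ĝ).mp fun g hg => (mem_zeroLocus_iff.mp hx𝔮) g (h𝔞𝔮 hg)
      have hc₀ : π (dh ĝ) ∈ Q := (hmemQ _).mpr ⟨_, hE', rfl⟩
      have hmem : (Fin.cons 1 (rep (π (dh ĝ))) : Torus (d + 1))⁻¹ * ĝ ∈ subtorus Â := by
        rw [hcone]
        exact QuotientGroup.eq.mp (hrep _ hc₀).2
      rw [map_prod]
      exact Finset.prod_eq_zero hc₀ ((mem_vanishingIdeal_iff.mp (hfI _ hc₀)) _ ⟨ĝ, hmem, rfl⟩)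
    obtain ⟨c, hc, hfc⟩ := (Ideal.IsPrime.prod_mem_iff (p := 𝔮)).mp hF
    exact hf𝔮 c hc hfc
  -- (P4) every relevant minimal prime of `𝔞` has dimension `≤ ν`
  have hmax : ∀ 𝔮 ∈ 𝔞.minimalPrimes, (∀ j, (X j : MvPolynomial (Fin (d + 1)) ℂ) ∉ 𝔮) →
      ringKrullDim (MvPolynomial (Fin (d + 1)) ℂ ⧸ 𝔮) ≤ (a + 1 : ℕ) := by
    intro 𝔮 h𝔮 hrel
    obtain ⟨c, -, hle⟩ := hP3 𝔮 h𝔮.1.1 hrel h𝔮.1.2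
    rw [← hν, ← hdimc c]
    exact ringKrullDim_le_of_surjective (Ideal.Quotient.factor hle) (Ideal.Quotient.factor_surjective _)
  -- (P5) the `𝔭 c`, `c ∈ Q`, are relevant minimal primes of `𝔞` of dimension `ν`
  have h𝔞le : ∀ c ∈ Q, 𝔞 ≤ 𝔭 c := by
    intro c hc
    refine le_trans ?_ (h𝔭min c).1.2
    rw [h𝔞def, Ideal.span_le]
    rintro f hf
    rw [SetLike.mem_coe, mem_vanishingIdeal_iff]
    rintro _ ⟨ĝ, hĝ, rfl⟩
    exact ((hZ ĝ).mpr (hĈE c hc ĝ hĝ)) f (Ideal.subset_span hf)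
  have h𝔭𝔞 : ∀ c ∈ Q, 𝔭 c ∈ 𝔞.minimalPrimes := by
    intro c hc
    haveI := (h𝔭min c).1.1
    obtain ⟨𝔮, h𝔮min, h𝔮le⟩ := Ideal.exists_minimalPrimes_le (h𝔞le c hc)
    haveI := h𝔮min.1.1
    have hrel : ∀ j, (X j : MvPolynomial (Fin (d + 1)) ℂ) ∉ 𝔮 := fun j hj => hrel𝔭 c j (h𝔮le hj)
    obtain ⟨c', -, hIc'⟩ := hP3 𝔮 h𝔮min.1.1 hrel h𝔮min.1.2
    have h1 : ringKrullDim (MvPolynomial (Fin (d + 1)) ℂ ⧸ 𝔭 c) ≤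
        ringKrullDim (MvPolynomial (Fin (d + 1)) ℂ ⧸ 𝔮) :=
      ringKrullDim_le_of_surjective (Ideal.Quotient.factor h𝔮le) (Ideal.Quotient.factor_surjective _)
    have h2 : ringKrullDim (MvPolynomial (Fin (d + 1)) ℂ ⧸ 𝔮) ≤ ((a + 1 : ℕ) : WithBot ℕ∞) := by
      rw [← hν, ← hdimc c']
      exact ringKrullDim_le_of_surjective (Ideal.Quotient.factor hIc') (Ideal.Quotient.factor_surjective _)
    rw [h𝔭dim c] at h1
    have h𝔮dim : ringKrullDim (MvPolynomial (Fin (d + 1)) ℂ ⧸ 𝔮) = (a + 1 : ℕ) := le_antisymm h2 h1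
    rwa [← Literature.RingTheory.MvPolynomial.eq_of_le_of_ringKrullDim_quotient_eq h𝔮le h𝔮dim
      (h𝔭dim c)]
  -- (P6) `c ↦ 𝔭 c` is injective on `Q`
  have hinj : Set.InjOn 𝔭 ↑Q := by
    intro c hc c' hc' heq
    haveI := (h𝔭min c).1.1
    obtain ⟨x, hx𝔭, hxU⟩ := zeroLocus_inter_torus_nonempty (hrel𝔭 c)
    obtain ⟨ĝ, rfl⟩ := exists_torus_eq hxU
    have hin : ∀ c₁ ∈ Q, 𝔭 c₁ = 𝔭 c →
        (Fin.cons 1 (rep c₁) : Torus (d + 1))⁻¹ * ĝ ∈ subtorus Â := by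
      intro c₁ hc₁ he
      apply inv_mul_mem_subtorus_of_forall_aevalAt_eq_zero
      intro b hb
      have hbI : b ∈ vanishingIdeal ℂ
          ((fun (g : Torus (d + 1)) (i : Fin (d + 1)) => ((g i : ℂˣ) : ℂ)) '' {ĝ | (Fin.cons 1 (rep c₁) : Torus (d + 1))⁻¹ * ĝ ∈ subtorus Â}) := by
        rw [mem_vanishingIdeal_iff]
        rintro _ ⟨ĝ', hĝ', rfl⟩
        have := hb _ hĝ'
        rwa [mul_inv_cancel_left] at this
      exact (mem_zeroLocus_iff.mp hx𝔭) b (he ▸ (h𝔭min c₁).1.2 hbI)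
    have h1 := hin c hc rfl
    have h2 := hin c' hc' heq.symm
    rw [hcone] at h1 h2
    rw [← (hrep c hc).2, ← (hrep c' hc').2]
    exact (QuotientGroup.eq.mpr h1).trans (QuotientGroup.eq.mpr h2).symm
  -- the Bézout-type count
  haveI : Infinite ℂ := Infinite.of_injective (Nat.cast : ℕ → ℂ) Nat.cast_injective
  have hcount := Literature.RingTheory.MvPolynomial.card_le_pow_of_relevant_minimalPrimes
    (K := ℂ) (a := a) hD h𝔞def
    (by
      rintro _ ⟨q, hq, rfl⟩
      exact ⟨D, le_rfl, isHomogeneous_homogenization (hdeg q hq)⟩)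
    hmax (Q.image 𝔭)
    (by
      intro P hP
      obtain ⟨c, hc, rfl⟩ := Finset.mem_image.mp hP
      exact ⟨h𝔭𝔞 c hc, hrel𝔭 c, h𝔭dim c⟩)
  rw [Finset.card_image_of_injOn hinj] at hcount
  refine hcount.trans (Nat.pow_le_pow_right hD ?_)
  omega


end Literature.NumberTheory.Transcendental

end
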